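import Summits.Langlands.Langlands.Theses.EisensteinDegreeShift
import Literature.NumberTheory.GaloisRepresentations.OrdinaryRegular
import Literature.NumberTheory.Automorphic.OrdinaryCompletedCohomologyGL
import Literature.NumberTheory.Automorphic.GLnAdelicStructureProofs

/-!
# Crux `EisensteinSeededLifting` (route `EisensteinDegreeShift`, item stmt-Langlands-18369) — ALT line `Lines/ordsplit.lean`

Strategist line (crux-strategist seat `cstrat-stmt-Langlands-18369-s1`), an ALTERNATIVE to — never a
replacement of — the live skeleton `Lines/birth.lean`, which it does not touch.  Shape D-0027 §3.3: precise stub statements `Sig.stub_<name> : Prop`,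
registered stubs `theorem stub_<name> : Sig.stub_<name> := by sorry` (the ONLY `sorry`s of the file), the
kernel-checked composition `EisensteinSeededLifting_of : Sig.stub_ordProAutomorphy → Sig.stub_ordClassicality →
Sig.stub_nonOrdPotentialLifting → Sig.stub_solubleDescent → EisensteinSeededLifting` (no `sorry`), and the
skeleton theorem `EisensteinSeededLifting_proof` concluding the crux BY NAME.  (Registered under its own subpath
`Lines/ordsplit.lean` with `ledger skeleton check … --crux stmt-Langlands-18369`; card `Lines/ordsplit.md`.)

## THE CUT — regime split at `p` (locally Borel = ordinary | not), potential conclusion, soluble descent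

WHY A DIFFERENT CUT FROM `birth`.  The birth line funnels the whole crux into ONE stub
(`stub_liftingFlatTarget`) whose intended proof is FIXED-WEIGHT Calegari–Geraghty / ACC+ patching of the
`GL_n/K` complexes over the Fontaine–Laffaille pseudodeformation ring at the Eisenstein maximal ideal.  That
proof shape has an intrinsic numerical defect at a residually SPLIT reducible `ρ̄ = χ̄₁ ⊕ ⋯ ⊕ χ̄ₙ` (which is
exactly the frame `birth` reduces to): a Taylor–Wiles prime `q` (`q ≡ 1 mod p^N`, `ρ̄(Frob_q)` regular
semisimple, hence diagonal in the split frame) imposes local conditions that are DIAGONAL in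
`ad ρ̄ = ⊕_{i,j} χ̄ᵢ χ̄ⱼ⁻¹`; the dual Selmer classes such primes can annihilate live in the diagonal summands,
while the off-diagonal pieces `H¹(K, χ̄ᵢχ̄ⱼ⁻¹ ε̄)`, `i ≠ j`, are untouched by every admissible `q` — and they
are non-zero precisely when an Eisenstein-congruent cuspidal seed exists (Ribet's lemma: the seed `ρ₁`
produces a lattice with non-split reduction, i.e. a class in `H¹(K, χ̄ᵢχ̄ⱼ⁻¹)`).  So the presentation of the
global (pseudo)deformation ring over the local one needs `g + δ` generators against `g` Taylor–Wiles
relations, `δ > 0`, and the Calegari–Geraghty support numerology `dim R_∞ = dim S_∞ − l₀` fails by `δ`.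
This is Skinner–Wiles' original observation (fixed-level deformation rings at reducible `ρ̄` have components
of too large dimension "coming from the various reducible deformations", PNAS 94 (1997) p. 10520) in the
`l₀ > 0` setting.  EVERY printed residually-reducible lifting theorem gets its room elsewhere: from a
`p`-ADIC FAMILY of Krull dimension ≥ 2 — Hida / `Λ`-adic Hecke algebras (Skinner–Wiles 1999, Thorne 2015,
Allen–Newton–Thorne 2020) or completed cohomology (Pan 2022, where `𝕋_𝔪` has dimension `≥ 2[F:ℚ]+1`) — in
which one-dimensional characteristic-`p` primes `𝔮` with `ρ(𝔮)` absolutely IRREDUCIBLE ("nice primes",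
Pan, JAMS 35 (2022) Def. 9.0.17, Prop. 9.0.18–9.0.20, Lemma 9.0.21) exist on every component, and patching
is run relative to `ρ(𝔮)`, where the `δ`-defect is absent.  A fixed-weight `𝕋_𝔪` is finite over `O`: its
only one-dimensional characteristic-`p` prime is `𝔪` itself.  Hence any proof "as the route intends" must
LEAVE FIXED WEIGHT, and the regime in which a family with the required properties is available today is the
ORDINARY one (Hida theory for `GL_n` over CM fields without self-duality: Khare–Thorne, Amer. J. Math. 139
(2017) §6; ACC+ = Allen–Calegari–Caraiani–Gee–Helm–Le Hung–Newton–Scholze–Taylor–Thorne, Ann. of Math. 197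
(2023) §5.2 "Hida theory", §6.6, Thm. 6.1.2).

THE REGIME PREDICATE (datum-free, weight-general).  `ORD(ρ) :≡ ∀ v ∣ p, ∃ g ∈ GL_n(ℚ̄_p), g ρ|_{Γ_{K_v}} g⁻¹
is upper triangular` (`FramedRep.IsUpperTriangular` of `FramedRep.conj g (ρ.toLocal v)`), i.e. `ρ|_{Γ_{K_v}}`
stabilises a full flag.  Under the crux's standing hypotheses (crystalline at `v` for Fontaine's pinned
datum, `n` distinct labelled Hodge–Tate weights) this is EQUIVALENT to "crystalline-ordinary of the weight of
`ρ`" (the graded characters are crystalline characters; wrong-order crystalline extensions of characters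
with distinct weights split, `H¹_f = 0`, so the flag can be reordered to Greenberg's) — and it needs no local
Artin datum (the tree's `IsOrdinaryRegularAt` takes a `LocalArtinData`, over which one must not quantify)
and no parallel-weight restriction (the tree's cyclotomic `IsCrystallineOrdinaryAt`).

THE STUBS (engine / exit seam of Skinner–Wiles, as in the in-tree sibling route `SkinnerWilesDefectOne`
= `ReducibleOrdinaryProModular ∧ ProModularOrdinaryClassical` at `n = 2`, `K` imaginary quadratic, parallel weight).
* `stub_ordProAutomorphy` (XL; ENGINE, the live frontier WITH a mechanism): crux hypotheses + `ORD(ρ)` ⟹ there is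
  a finite soluble Galois CM extension `K'/K` with `ρ|_{Γ_{K'}}` irreducible and ORDINARILY `p`-ADICALLY AUTOMORPHIC
  of some tame level (`BigHeckeGLn.TameLevel.IsOrdinarilyPadicallyAutomorphic 𝒰' (ρ.restrictField K')`: associated
  with a continuous `ℚ̄_p`-point of Hida's ordinary big Hecke algebra `𝕋^{S,ord}(𝒰')` of the `GL_n/K'` Hida tower,
  CONSTRUCTED in `Literature/NumberTheory/Automorphic/OrdinaryCompletedCohomologyGL.lean`).  Mechanism (transplant,
  not a cite): Skinner–Wiles / Thorne / Allen–Newton–Thorne `Λ`-adic nice-prime patching run on the NON-polarized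
  ordinary family (Khare–Thorne / ACC+ §5.2, Calegari–Geraghty patching of complexes in families), Galois input
  at the Eisenstein ideal from A'Campo–Hevesi–Thorne–Whitmore (arXiv:2607.11763, Prop. 5.2.8 / Thm. 1.2.1), the
  Steinberg seed bounding the reducible locus (Thorne 2015 §7, relation (7.2)), soluble base change in which
  `v₀` splits into many places to win the reducible-locus inequality (the reason the conclusion is POTENTIAL).
* `stub_ordClassicality` (L–XL; EXIT): an irreducible, a.e. unramified `ρ`, crystalline with distinct labelled
  weights and locally Borel at `p`, whose restriction to a CM `K'` is irreducible and ordinarily `p`-adically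
  automorphic, is classically automorphic over `K'` (Hida control / independence of weight for the ordinary
  completed cohomology of `GL_n/K'`, Khare–Thorne 2017 §6 / ACC+ 2023 §5.2; Franke; irreducibility ⇒ cuspidal).
* `stub_nonOrdPotentialLifting` (open kernel; HARDEST): crux hypotheses + `¬ ORD(ρ)` ⟹ potential CLASSICAL
  automorphy over a soluble Galois CM `K'/K`.  No family with nice primes is available off the ordinary locus for
  `GL_n` over a CM field (`l₀ > 0`: completed cohomology has the conjectural codimension `l₀` of Calegari–Emerton /
  Gee–Newton, no classicality for non-ordinary finite-slope eigenclasses in this generality); recorded as the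
  honest open piece.
* `stub_solubleDescent` := the route's own support item `SolubleDescentGLn` (stmt-Langlands-18371) BY NAME
  (Arthur–Clozel cyclic descent along a soluble CM tower given the irreducible Galois representation; size L).

Composition: case split on `ORD(ρ)` (classical); ordinary: engine → exit (with the tree theorem
`isCompact_glFiniteIntegralLevel_holds n K'`) → descent; non-ordinary: open kernel → descent.  Kernel-checked
below; the crux is concluded BY NAME.
-/

namespace Summit.Langlands.Langlands.Cruxes.EisensteinSeededLifting.OrdSplit

open scoped MatrixGroups

/-! ## Stub statements (`Sig.stub_<name> : Prop`) and registered stubs (`theorem stub_<name>`, the only `sorry`s) -/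

/-- **ENGINE — potential ordinary pro-automorphy from an Eisenstein–Steinberg seed** (size XL; the
frontier piece WITH a mechanism).  Verbatim the hypotheses of the crux `EisensteinSeededLifting` (CM `K`,
`2 ≤ n < p`, `p` unramified in `K`, `O` the valuation ring of `ℚ̄_p`, `ρ` irreducible, unramified a.e., with
a residually upper-triangular integral model `ρ₀`, crystalline at every `v ∣ p` for Fontaine's pinned datum
with `n` distinct labelled Hodge–Tate weights in an interval of length `≤ p − 2`, and the cuspidal Steinberg
seed `(v₀, π₀, ρ₁, ρ₁₀, r)`), PLUS the regime hypothesis inserted before the seed: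
`ORD(ρ) :≡ ∀ v ∣ p, ∃ g, g ρ|_{Γ_{K_v}} g⁻¹ upper triangular` (equivalently, given crystallinity and distinct
weights: `ρ` is crystalline-ordinary at every `v ∣ p`).  CONCLUSION (Skinner–Wiles' "ρ is pro-modular",
potential form, in the tree's vocabulary): there is a finite Galois extension `K'/K` with soluble group,
`K'` CM, such that `ρ|_{Γ_{K'}}` is irreducible and ORDINARILY `p`-ADICALLY AUTOMORPHIC of some `S`-good tame
level `𝒰'` — associated with a continuous `ℚ̄_p`-point of Hida's ordinary big Hecke algebra
`𝕋^{S,ord}(𝒰') = OrdinaryHeckeAlgebraGLn 𝒰'` of the `GL_n/K'` Hida tower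
(`BigHeckeGLn.TameLevel.IsOrdinarilyPadicallyAutomorphic`, constructed in
`Literature/NumberTheory/Automorphic/OrdinaryCompletedCohomologyGL.lean`).
Why plausibly true: reciprocity for `ρ|_{Γ_{K'}}` plus the existence of the ordinary refinement of a
crystalline-ordinary cuspidal eigensystem (the `R^{ord} → 𝕋^{ord}` direction produces the point directly).
Intended mechanism: `Λ`-adic nice-prime patching (Skinner–Wiles 1999; Thorne 2015 §4–7; Allen–Newton–Thorne
2020 — tree fact `AllenNewtonThorne2020.automorphyLifting_residuallyReducible_ordinary` is the POLARIZED
printed sibling) transplanted to the non-polarized ordinary family (Khare–Thorne 2017 §6, ACC+ 2023 §5.2,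
§6.6; in-tree sibling at `n = 2`, `K` imaginary quadratic: route `SkinnerWilesDefectOne`, crux
`ReducibleOrdinaryProModular`, line `Cruxes/ReducibleOrdinaryProModular/Lines/steinberg_hyperplane.lean`),
Eisenstein-ideal Galois input arXiv:2607.11763 Prop. 5.2.8, the Steinberg seed bounding the reducible locus
(Thorne 2015 §7, relation (7.2)), base change to a soluble CM `K'` in which `v₀` splits into many places to
win the reducible-locus / connectedness-dimension inequality — hence POTENTIAL.  Three named gaps: the
Galois determinant over `𝕋^{S,ord}(𝒰')_𝔪` at an Eisenstein `𝔪` with local–global compatibility at `p` and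
at Taylor–Wiles places; Calegari–Geraghty patching of the ordinary complexes relative to a nice prime; the
non-polarized reducible-locus count (line card, Cheapest falsifier). -/
def Sig.stub_ordProAutomorphy : Prop :=
    ∀ (K : Type) [Field K] [NumberField K], NumberField.IsCMField K → ∀ (n : ℕ), 2 ≤ n →
      ∀ (p : ℕ) [Fact p.Prime], n < p →
      (∀ v : IsDedekindDomain.HeightOneSpectrum (NumberField.RingOfIntegers K), ((p : ℕ) : NumberField.RingOfIntegers K) ∈ v.asIdeal → ¬ v.asIdeal ^ 2 ∣ Ideal.span {((p : ℕ) : NumberField.RingOfIntegers K)}) →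
      ∀ (O : ValuationSubring (PadicAlgCl p)), O = (Valued.v : Valuation (PadicAlgCl p) NNReal).valuationSubring →
      ∀ (hcpt : Literature.NumberTheory.Automorphic.isCompact_glFiniteIntegralLevel n K) (ι : PadicAlgCl p ≃+* ℂ)
        (ρ : Literature.NumberTheory.GaloisRepresentations.FramedGaloisRep K (PadicAlgCl p) n) (ρ₀ : Field.absoluteGaloisGroup K →* GL (Fin n) O),
      ρ.toGaloisRep.IsIrreducible →
      (∀ᶠ v : IsDedekindDomain.HeightOneSpectrum (NumberField.RingOfIntegers K) in Filter.cofinite, ρ.IsUnramifiedAt v) →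
      ρ.HasUpperTriangularIntegralModel ρ₀ →
      (∀ (v : IsDedekindDomain.HeightOneSpectrum (NumberField.RingOfIntegers K)) (hv : ((p : ℕ) : NumberField.RingOfIntegers K) ∈ v.asIdeal),
        let D := Literature.NumberTheory.PAdicHodge.fontainePstAdicCompletion v p hv;
        D.IsCrystallineFramed (ρ.toLocal v) ∧ (letI := D.algebra; ∀ τ : v.adicCompletion K →ₐ[ℚ_[p]] PadicAlgCl p,
          let M := ρ.labelledHodgeTateWeightsAt v D.algebra D.𝔅 τ.toRingHom;
          M.Nodup ∧ Multiset.card M = n ∧ ∀ a ∈ M, ∀ b ∈ M, a - b ≤ (p : ℤ) - 2)) →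
      (∀ (v : IsDedekindDomain.HeightOneSpectrum (NumberField.RingOfIntegers K)), ((p : ℕ) : NumberField.RingOfIntegers K) ∈ v.asIdeal →
        ∃ g : GL (Fin n) (PadicAlgCl p),
          (Literature.NumberTheory.GaloisRepresentations.FramedRep.conj g (ρ.toLocal v)).IsUpperTriangular) →
      (∃ v₀ : IsDedekindDomain.HeightOneSpectrum (NumberField.RingOfIntegers K), ((p : ℕ) : NumberField.RingOfIntegers K) ∉ v₀.asIdeal ∧ ρ.IsUnramifiedAt v₀ ∧
        ∃ (π₀ : Literature.NumberTheory.Automorphic.CuspidalAutomorphicRepData n K hcpt) (ρ₁ : Literature.NumberTheory.GaloisRepresentations.FramedGaloisRep K (PadicAlgCl p) n) (ρ₁₀ : Field.absoluteGaloisGroup K →* GL (Fin n) O),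
          π₀.1.IsLAlgebraic ∧
          (∀ᶠ v : IsDedekindDomain.HeightOneSpectrum (NumberField.RingOfIntegers K) in Filter.cofinite, Summit.Langlands.SatakeFrobCompatibleAt ι π₀.1 ρ₁ v) ∧
          ρ₁.toGaloisRep.IsIrreducible ∧ ρ₁.HasUpperTriangularIntegralModel ρ₁₀ ∧
          (∀ (g : Field.absoluteGaloisGroup K) (i : Fin n), ((ρ₁₀ g).val i i - (ρ₀ g).val i i : O) ∈ IsLocalRing.maximalIdeal O) ∧
          (∀ (v : IsDedekindDomain.HeightOneSpectrum (NumberField.RingOfIntegers K)) (hv : ((p : ℕ) : NumberField.RingOfIntegers K) ∈ v.asIdeal),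
            let D := Literature.NumberTheory.PAdicHodge.fontainePstAdicCompletion v p hv;
            D.IsCrystallineFramed (ρ₁.toLocal v) ∧ (letI := D.algebra; ∀ τ : v.adicCompletion K →ₐ[ℚ_[p]] PadicAlgCl p,
              ρ₁.labelledHodgeTateWeightsAt v D.algebra D.𝔅 τ.toRingHom = ρ.labelledHodgeTateWeightsAt v D.algebra D.𝔅 τ.toRingHom)) ∧
          ∃ r : Literature.NumberTheory.GaloisRepresentations.WeilDeligneRep (v₀.adicCompletion K) (PadicAlgCl p) (Fin n → PadicAlgCl p),
            Literature.NumberTheory.GaloisRepresentations.IsWeilDeligneOfLadic (ρ₁.toLocal v₀).toWeilGroupHom r ∧ r.N ^ (n - 1) ≠ 0) →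
      ∃ (K' : Type) (_ : Field K') (_ : NumberField K') (_ : Algebra K K'),
        IsGalois K K' ∧ IsSolvable (K' ≃ₐ[K] K') ∧ NumberField.IsCMField K' ∧
        (ρ.restrictField K').toGaloisRep.IsIrreducible ∧
        ∃ 𝒰' : Literature.NumberTheory.Automorphic.BigHeckeGLn.TameLevel n K' p,
          𝒰'.IsOrdinarilyPadicallyAutomorphic (ρ.restrictField K')

/-- Registered stub `stub_ordProAutomorphy` — statement `Sig.stub_ordProAutomorphy` (docstring above). -/
theorem stub_ordProAutomorphy : Sig.stub_ordProAutomorphy := by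
  sorry

/-- **EXIT — classicality of ordinary `p`-adic automorphic representations of regular crystalline weight**
(size L–XL; Hida control).  For `K` CM, `2 ≤ n < p`, `p` unramified in `K`, `ρ : Γ_K → GL_n(ℚ̄_p)`
irreducible, unramified a.e., crystalline at every `v ∣ p` (Fontaine's pinned datum) with `n` distinct
labelled weights in an interval of length `≤ p − 2`, and locally Borel at `p` (`ORD(ρ)`): for every CM
number field `K' ⊇ K` over which `ρ|_{Γ_{K'}}` stays irreducible and is ordinarily `p`-adically automorphic
of some tame level, `ρ|_{Γ_{K'}}` is CLASSICALLY automorphic — an L-algebraic cuspidal `π'` of `GL_n(𝔸_{K'})`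
is Satake–Frobenius compatible with it at almost all places.  Intended proof: the weight of the point
(diamond operators, `ordDiamondHom`) is the arithmetic weight read off the Hodge–Tate weights by ordinary
local–global compatibility in the family; Hida's control / independence-of-weight theorem for the ordinary
completed cohomology of `GL_n/K'` (Khare–Thorne 2017 Prop. 6.6-type; ACC+ 2023 §5.2) places the eigensystem
in `H^•(X_{U(c)}, V_λ)^{ord} ⊗ ℚ̄_p` up to the `l₀ > 0` torsion phenomena; Franke / Borel–Jacquet and
irreducibility of `ρ|_{Γ_{K'}}` make it cuspidal, `T_{w,j} ↦` Satake parameters.  In-tree sibling at `n = 2`,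
`K'` imaginary quadratic, parallel weight: route `SkinnerWilesDefectOne`, crux `ProModularOrdinaryClassical`
(there typed with the full-tower predicate `IsPadicallyAutomorphic`, which additionally needs Emerton's
"Galois-ordinary ⇒ slope zero" step; the ordinary predicate used here does not).  The `p`-adic Hodge
hypotheses are certified over `K` (before restriction) on purpose: base change of Fontaine's pinned datum is
the prover's bookkeeping, not a stub. -/
def Sig.stub_ordClassicality : Prop :=
    ∀ (K : Type) [Field K] [NumberField K], NumberField.IsCMField K → ∀ (n : ℕ), 2 ≤ n →
      ∀ (p : ℕ) [Fact p.Prime], n < p →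
      (∀ v : IsDedekindDomain.HeightOneSpectrum (NumberField.RingOfIntegers K), ((p : ℕ) : NumberField.RingOfIntegers K) ∈ v.asIdeal → ¬ v.asIdeal ^ 2 ∣ Ideal.span {((p : ℕ) : NumberField.RingOfIntegers K)}) →
      ∀ (ι : PadicAlgCl p ≃+* ℂ) (ρ : Literature.NumberTheory.GaloisRepresentations.FramedGaloisRep K (PadicAlgCl p) n),
      ρ.toGaloisRep.IsIrreducible →
      (∀ᶠ v : IsDedekindDomain.HeightOneSpectrum (NumberField.RingOfIntegers K) in Filter.cofinite, ρ.IsUnramifiedAt v) →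
      (∀ (v : IsDedekindDomain.HeightOneSpectrum (NumberField.RingOfIntegers K)) (hv : ((p : ℕ) : NumberField.RingOfIntegers K) ∈ v.asIdeal),
        let D := Literature.NumberTheory.PAdicHodge.fontainePstAdicCompletion v p hv;
        D.IsCrystallineFramed (ρ.toLocal v) ∧ (letI := D.algebra; ∀ τ : v.adicCompletion K →ₐ[ℚ_[p]] PadicAlgCl p,
          let M := ρ.labelledHodgeTateWeightsAt v D.algebra D.𝔅 τ.toRingHom;
          M.Nodup ∧ Multiset.card M = n ∧ ∀ a ∈ M, ∀ b ∈ M, a - b ≤ (p : ℤ) - 2)) →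
      (∀ (v : IsDedekindDomain.HeightOneSpectrum (NumberField.RingOfIntegers K)), ((p : ℕ) : NumberField.RingOfIntegers K) ∈ v.asIdeal →
        ∃ g : GL (Fin n) (PadicAlgCl p),
          (Literature.NumberTheory.GaloisRepresentations.FramedRep.conj g (ρ.toLocal v)).IsUpperTriangular) →
      ∀ (K' : Type) [Field K'] [NumberField K'] [Algebra K K'], NumberField.IsCMField K' →
      (ρ.restrictField K').toGaloisRep.IsIrreducible →
      (∃ 𝒰' : Literature.NumberTheory.Automorphic.BigHeckeGLn.TameLevel n K' p,
        𝒰'.IsOrdinarilyPadicallyAutomorphic (ρ.restrictField K')) →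
      ∀ (hcpt' : Literature.NumberTheory.Automorphic.isCompact_glFiniteIntegralLevel n K'),
      ∃ π' : Literature.NumberTheory.Automorphic.CuspidalAutomorphicRepData n K' hcpt',
        π'.1.IsLAlgebraic ∧
        ∀ᶠ w : IsDedekindDomain.HeightOneSpectrum (NumberField.RingOfIntegers K') in Filter.cofinite,
          Summit.Langlands.SatakeFrobCompatibleAt ι π'.1 (ρ.restrictField K') w

/-- Registered stub `stub_ordClassicality` — statement `Sig.stub_ordClassicality` (docstring above). -/
theorem stub_ordClassicality : Sig.stub_ordClassicality := by
  sorry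

/-- **Eisenstein-seeded POTENTIAL lifting OFF the ordinary locus** (the open kernel of the crux; HARDEST).
Same hypotheses as `Sig.stub_ordProAutomorphy` with the regime hypothesis NEGATED, and the POTENTIAL CLASSICAL conclusion
(soluble Galois CM `K'/K`, `ρ|_{Γ_{K'}}` irreducible, an L-algebraic cuspidal `π'` on `GL_n(𝔸_{K'})` Satake–Frobenius compatible a.e.): `¬ (∀ v ∣ p, ∃ g, g ρ|_{Γ_{K_v}} g⁻¹ upper triangular)` — at some `v ∣ p` the crystalline
`ρ|_{Γ_{K_v}}` stabilises no full flag (non-ordinary).  Why plausibly true: a special case of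
Fontaine–Mazur–Langlands reciprocity (implied by the summit).  No mechanism in print: every
residually-reducible lifting theorem (SW99, Thorne15, ANT20, Pan22 for `GL₂/ℚ`) needs a `p`-adic family with
irreducible one-dimensional characteristic-`p` specialisations; off the ordinary locus for `GL_n` over a CM
field the only candidate is completed cohomology, whose codimension-`l₀` / patching formalism (Gee–Newton,
arXiv:1609.06965) is conjectural and lacks a classicality theorem.  Recorded as the honest open piece so
that the ordinary piece can be attacked separately. -/
def Sig.stub_nonOrdPotentialLifting : Prop :=
    ∀ (K : Type) [Field K] [NumberField K], NumberField.IsCMField K → ∀ (n : ℕ), 2 ≤ n →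
      ∀ (p : ℕ) [Fact p.Prime], n < p →
      (∀ v : IsDedekindDomain.HeightOneSpectrum (NumberField.RingOfIntegers K), ((p : ℕ) : NumberField.RingOfIntegers K) ∈ v.asIdeal → ¬ v.asIdeal ^ 2 ∣ Ideal.span {((p : ℕ) : NumberField.RingOfIntegers K)}) →
      ∀ (O : ValuationSubring (PadicAlgCl p)), O = (Valued.v : Valuation (PadicAlgCl p) NNReal).valuationSubring →
      ∀ (hcpt : Literature.NumberTheory.Automorphic.isCompact_glFiniteIntegralLevel n K) (ι : PadicAlgCl p ≃+* ℂ)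
        (ρ : Literature.NumberTheory.GaloisRepresentations.FramedGaloisRep K (PadicAlgCl p) n) (ρ₀ : Field.absoluteGaloisGroup K →* GL (Fin n) O),
      ρ.toGaloisRep.IsIrreducible →
      (∀ᶠ v : IsDedekindDomain.HeightOneSpectrum (NumberField.RingOfIntegers K) in Filter.cofinite, ρ.IsUnramifiedAt v) →
      ρ.HasUpperTriangularIntegralModel ρ₀ →
      (∀ (v : IsDedekindDomain.HeightOneSpectrum (NumberField.RingOfIntegers K)) (hv : ((p : ℕ) : NumberField.RingOfIntegers K) ∈ v.asIdeal),
        let D := Literature.NumberTheory.PAdicHodge.fontainePstAdicCompletion v p hv;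
        D.IsCrystallineFramed (ρ.toLocal v) ∧ (letI := D.algebra; ∀ τ : v.adicCompletion K →ₐ[ℚ_[p]] PadicAlgCl p,
          let M := ρ.labelledHodgeTateWeightsAt v D.algebra D.𝔅 τ.toRingHom;
          M.Nodup ∧ Multiset.card M = n ∧ ∀ a ∈ M, ∀ b ∈ M, a - b ≤ (p : ℤ) - 2)) →
      ¬ (∀ (v : IsDedekindDomain.HeightOneSpectrum (NumberField.RingOfIntegers K)), ((p : ℕ) : NumberField.RingOfIntegers K) ∈ v.asIdeal →
        ∃ g : GL (Fin n) (PadicAlgCl p),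
          (Literature.NumberTheory.GaloisRepresentations.FramedRep.conj g (ρ.toLocal v)).IsUpperTriangular) →
      (∃ v₀ : IsDedekindDomain.HeightOneSpectrum (NumberField.RingOfIntegers K), ((p : ℕ) : NumberField.RingOfIntegers K) ∉ v₀.asIdeal ∧ ρ.IsUnramifiedAt v₀ ∧
        ∃ (π₀ : Literature.NumberTheory.Automorphic.CuspidalAutomorphicRepData n K hcpt) (ρ₁ : Literature.NumberTheory.GaloisRepresentations.FramedGaloisRep K (PadicAlgCl p) n) (ρ₁₀ : Field.absoluteGaloisGroup K →* GL (Fin n) O),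
          π₀.1.IsLAlgebraic ∧
          (∀ᶠ v : IsDedekindDomain.HeightOneSpectrum (NumberField.RingOfIntegers K) in Filter.cofinite, Summit.Langlands.SatakeFrobCompatibleAt ι π₀.1 ρ₁ v) ∧
          ρ₁.toGaloisRep.IsIrreducible ∧ ρ₁.HasUpperTriangularIntegralModel ρ₁₀ ∧
          (∀ (g : Field.absoluteGaloisGroup K) (i : Fin n), ((ρ₁₀ g).val i i - (ρ₀ g).val i i : O) ∈ IsLocalRing.maximalIdeal O) ∧
          (∀ (v : IsDedekindDomain.HeightOneSpectrum (NumberField.RingOfIntegers K)) (hv : ((p : ℕ) : NumberField.RingOfIntegers K) ∈ v.asIdeal),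
            let D := Literature.NumberTheory.PAdicHodge.fontainePstAdicCompletion v p hv;
            D.IsCrystallineFramed (ρ₁.toLocal v) ∧ (letI := D.algebra; ∀ τ : v.adicCompletion K →ₐ[ℚ_[p]] PadicAlgCl p,
              ρ₁.labelledHodgeTateWeightsAt v D.algebra D.𝔅 τ.toRingHom = ρ.labelledHodgeTateWeightsAt v D.algebra D.𝔅 τ.toRingHom)) ∧
          ∃ r : Literature.NumberTheory.GaloisRepresentations.WeilDeligneRep (v₀.adicCompletion K) (PadicAlgCl p) (Fin n → PadicAlgCl p),
            Literature.NumberTheory.GaloisRepresentations.IsWeilDeligneOfLadic (ρ₁.toLocal v₀).toWeilGroupHom r ∧ r.N ^ (n - 1) ≠ 0) →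
      ∃ (K' : Type) (_ : Field K') (_ : NumberField K') (_ : Algebra K K'),
        IsGalois K K' ∧ IsSolvable (K' ≃ₐ[K] K') ∧ NumberField.IsCMField K' ∧
        (ρ.restrictField K').toGaloisRep.IsIrreducible ∧
        ∃ (hcpt' : Literature.NumberTheory.Automorphic.isCompact_glFiniteIntegralLevel n K')
          (π' : Literature.NumberTheory.Automorphic.CuspidalAutomorphicRepData n K' hcpt'),
          π'.1.IsLAlgebraic ∧
          ∀ᶠ w : IsDedekindDomain.HeightOneSpectrum (NumberField.RingOfIntegers K') in Filter.cofinite,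
            Summit.Langlands.SatakeFrobCompatibleAt ι π'.1 (ρ.restrictField K') w

/-- Registered stub `stub_nonOrdPotentialLifting` — statement `Sig.stub_nonOrdPotentialLifting` (docstring above). -/
theorem stub_nonOrdPotentialLifting : Sig.stub_nonOrdPotentialLifting := by
  sorry

/-- **Soluble descent** — literally the route's support item `SolubleDescentGLn` (stmt-Langlands-18371) BY
NAME: for `K'/K` finite Galois with soluble group, `K`, `K'` CM, `ρ` irreducible on `Γ_K` and on `Γ_{K'}`,
L-algebraic cuspidal Satake–Frobenius compatibility a.e. over `K'` descends to `K` (Arthur–Clozel cyclic base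
change / descent along the soluble tower, strong multiplicity one, Chebotarev; ACC+ 2023 soluble descent
lemma).  Size L, printed mathematics; shared with the route's `closes`. -/
def Sig.stub_solubleDescent : Prop :=
  Summit.Langlands.Langlands.Theses.EisensteinDegreeShift.SolubleDescentGLn

/-- Registered stub `stub_solubleDescent` — statement `Sig.stub_solubleDescent` = `SolubleDescentGLn`. -/
theorem stub_solubleDescent : Sig.stub_solubleDescent := by
  sorry

/-! ## Composition (sorry-free) and the skeleton theorem -/

/-- **Composition** (kernel-checked, no `sorry`): split on the regime `ORD(ρ)` (classically).  Ordinary: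
the ENGINE yields a soluble Galois CM `K'/K` with `ρ|_{Γ_{K'}}` irreducible and ordinarily `p`-adically
automorphic, the EXIT makes it classical over `K'` (compactness of `GL_n(𝒪̂_{K'})` is the tree theorem
`isCompact_glFiniteIntegralLevel_holds`), `SolubleDescentGLn` descends to `K`.  Non-ordinary: the open-kernel
stub yields `(K', π')` directly, then descent. -/
theorem EisensteinSeededLifting_of :
    Sig.stub_ordProAutomorphy → Sig.stub_ordClassicality → Sig.stub_nonOrdPotentialLifting →
    Sig.stub_solubleDescent →
    Summit.Langlands.Langlands.Theses.EisensteinDegreeShift.EisensteinSeededLifting := by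
  intro hE hX h2 h3 K _ _ hK n hn p _ hp hur O hO hcpt ι ρ ρ₀ hirr hae hut hFL hseed
  rcases Classical.em (∀ (v : IsDedekindDomain.HeightOneSpectrum (NumberField.RingOfIntegers K)),
      ((p : ℕ) : NumberField.RingOfIntegers K) ∈ v.asIdeal →
        ∃ g : GL (Fin n) (PadicAlgCl p),
          (Literature.NumberTheory.GaloisRepresentations.FramedRep.conj g (ρ.toLocal v)).IsUpperTriangular)
    with hord | hord
  · obtain ⟨K', _, _, _, hgal, hsol, hK', hirr', 𝒰', hpa⟩ :=
      hE K hK n hn p hp hur O hO hcpt ι ρ ρ₀ hirr hae hut hFL hord hseed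
    have hcpt' : Literature.NumberTheory.Automorphic.isCompact_glFiniteIntegralLevel n K' :=
      Literature.NumberTheory.Automorphic.isCompact_glFiniteIntegralLevel_holds n K'
    obtain ⟨π', hLalg', hSat'⟩ := hX K hK n hn p hp hur ι ρ hirr hae hFL hord K' hK' hirr' ⟨𝒰', hpa⟩ hcpt'
    exact h3 K K' hgal hsol hK hK' n p hcpt hcpt' ι ρ hirr hirr' ⟨π', hLalg', hSat'⟩
  · obtain ⟨K', _, _, _, hgal, hsol, hK', hirr', hcpt', π', hLalg', hSat'⟩ :=
      h2 K hK n hn p hp hur O hO hcpt ι ρ ρ₀ hirr hae hut hFL hord hseed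
    exact h3 K K' hgal hsol hK hK' n p hcpt hcpt' ι ρ hirr hirr' ⟨π', hLalg', hSat'⟩

/-- **THE SKELETON THEOREM (registrar shape, D-0027 §3.3).** The crux
`Summit.Langlands.Langlands.Theses.EisensteinDegreeShift.EisensteinSeededLifting` concluded BY NAME from the
four registered stubs through the sorry-free composition `EisensteinSeededLifting_of` (depends on `sorryAx`
only through the stubs). -/
theorem EisensteinSeededLifting_proof :
    Summit.Langlands.Langlands.Theses.EisensteinDegreeShift.EisensteinSeededLifting :=
  EisensteinSeededLifting_of stub_ordProAutomorphy stub_ordClassicality stub_nonOrdPotentialLifting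
    stub_solubleDescent

end Summit.Langlands.Langlands.Cruxes.EisensteinSeededLifting.OrdSplit
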